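import Summits.RiemannHypothesis.RiemannHypothesis.Theorems.SuzukiStructureFunctionsConvolution

/-!
# SuzukiStructureFunctionsHalfPlane — the half-plane formulas (3.27)₂ of Suzuki JFA21:
# `𝔄(t,z) = ½E(z)(e^{izt} + ∫_t^∞ φ⁺(t,x)e^{izx} dx)`, `−i𝔅(t,z) = ½E(z)(e^{izt} − ∫_t^∞ φ⁻(t,x)e^{izx} dx)` for
# `Im z > c`, and `E(t,z)` explicitly from the kernel (column DBR; RH-FREE)

LINE 1 — LABEL: RH-FREE (identities for ANY Suzuki pair `(ϱ, K)` on any solvable window; no `ζ`, no zeros, no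
positivity); bears_on LADDER-RH B-D → B-P(P1)/(P3) (the column's de Branges object `E(t,z)`).
WHAT THIS IS NOT: not progress toward RH; nothing here bears on the truth of RH.

Source: M. Suzuki, J. Funct. Anal. 281 (2021) 109116 = arXiv:1606.05726 [Suzuki2021Hamiltonians], Lemma 3.7 and
eq. (3.27) (second form), with (3.38)–(3.39).

Contents (seat rh-dbr-eng-5 g7; continuation of `SuzukiStructureFunctionsConvolution`, p485142):
* `integrableOn_suzukiPhiExt_mul_cexp_Ioi` — Lemma 3.7 in integrability form: `x ↦ φ^ε(t,x)e^{izx}` is integrable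
  on `(t,∞)` for `Im z > c` (`c` = exponential growth rate of `K`);
* `fourier_frakFG_eq` — `𝖥(frakFG ε t)(z) = ½E(z)(e^{izt} + ε∫_{(t,∞)} φ^ε(t,x)e^{izx} dx)` for `Im z > c`, `E = 𝖥ϱ`
  (Fubini via Mathlib's `Integrable.convolution_integrand`; inner integral `∫ϱ(x−y)e^{izx}dx = e^{izy}E(z)`);
* `frakA_eq_halfPlane`, `neg_I_mul_frakB_eq_halfPlane` — (3.27)₂ AS PRINTED;
* `structE_eq_halfPlane` — `E(t,z) = ½E(z)(m(t)(e^{izt} + ∫_t^∞φ⁺e^{izx}) + m(t)⁻¹(e^{izt} − ∫_t^∞φ⁻e^{izx}))`: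
  the chain's structure function is the initial `E` times explicit Laplace transforms of `φ^{±}(t,·)`.
-/

noncomputable section

-- D-0017: `Summit.<S>.<S>.…` is the designed namespace of a single-problem summit.
set_option linter.dupNamespace false

open MeasureTheory Set Complex Filter Topology
open scoped ComplexConjugate

namespace Summit.RiemannHypothesis.RiemannHypothesis.Theorems.SuzukiStructureFunctions

open Literature.NumberTheory.LFunctions Literature.NumberTheory.LFunctions.SuzukiStructure
open Summit.RiemannHypothesis.RiemannHypothesis.Theorems.SuzukiPhiExistence (continuous_suzukiPhiExt)

variable {ϱ K : ℝ → ℝ} {ε t : ℝ}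

/-! ## §10 Lemma 3.7 ⇒ the half-plane formulas (3.27)₂: `𝔄(t,z) = ½E(z)(e^{izt} + ∫_t^∞ φ⁺(t,x)e^{izx} dx)`,
`−i𝔅(t,z) = ½E(z)(e^{izt} − ∫_t^∞ φ⁻(t,x)e^{izx} dx)` for `Im z > c` -/

/-- RH-FREE. `‖e^{izx}‖ = e^{−(Im z)·x}` for real `x`. -/
theorem norm_cexp_I_mul_eq (z : ℂ) (x : ℝ) : ‖cexp (I * z * x)‖ = Real.exp (-(z.im * x)) := by
  rw [Complex.norm_exp]
  congr 1
  simp [Complex.mul_re, Complex.mul_im]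

/-- RH-FREE. **Lemma 3.7, integrability form:** on a solvable window with `|K| ≤ C_K e^{c|·|}` (`c ≥ 0`), the
Laplace integrand `x ↦ φ^ε(t,x)e^{izx}` is integrable on `(t,∞)` for every `z` with `Im z > c` («the right-hand
sides of (3.27) are analytic on `Im z > c` by (K1) and Lemma 3.7»). -/
theorem integrableOn_suzukiPhiExt_mul_cexp_Ioi (hK : Continuous K) (hK3 : ∀ u : ℝ, u < 0 → K u = 0)
    {c CK : ℝ} (hc : 0 ≤ c) (hKle : ∀ x : ℝ, |K x| ≤ CK * Real.exp (c * |x|))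
    (hsol : ∃ X : ℝ → ℝ, IsSuzukiPhiSolution K ε t X) {z : ℂ} (hz : c < z.im) :
    IntegrableOn (fun x : ℝ => (suzukiPhiExt K ε t x : ℂ) * cexp (I * z * x)) (Ioi t) := by
  obtain ⟨C, hC⟩ := abs_suzukiPhiExt_le hK3 hc hKle hsol
  have hC0 : 0 ≤ C := by
    have := (abs_nonneg _).trans (hC 0)
    simpa using this
  have hφc : Continuous (suzukiPhiExt K ε t) := continuous_suzukiPhiExt hK hK3 ε t
  have hcont : Continuous fun x : ℝ => (suzukiPhiExt K ε t x : ℂ) * cexp (I * z * x) := by fun_prop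
  -- split `(t,∞) = (t, t₀] ∪ (t₀,∞)` with `t₀ = max t 0`
  set t₀ : ℝ := max t 0 with ht₀
  have h1 : IntegrableOn (fun x : ℝ => (suzukiPhiExt K ε t x : ℂ) * cexp (I * z * x)) (Ioc t t₀) :=
    (hcont.integrableOn_Icc (a := t) (b := t₀)).mono_set Ioc_subset_Icc_self
  have h2 : IntegrableOn (fun x : ℝ => (suzukiPhiExt K ε t x : ℂ) * cexp (I * z * x)) (Ioi t₀) := by
    refine Integrable.mono' ((exp_neg_integrableOn_Ioi t₀ (sub_pos.2 hz)).const_mul C)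
      hcont.aestronglyMeasurable.restrict
      ((ae_restrict_iff' measurableSet_Ioi).2 (Eventually.of_forall fun x hx => ?_))
    have hx0 : 0 ≤ x := (le_max_right t 0).trans (le_of_lt hx)
    rw [norm_mul, Complex.norm_real, Real.norm_eq_abs, norm_cexp_I_mul_eq]
    calc |suzukiPhiExt K ε t x| * Real.exp (-(z.im * x)) ≤ C * Real.exp (c * |x|) * Real.exp (-(z.im * x)) :=
          mul_le_mul_of_nonneg_right (hC x) (Real.exp_pos _).le
      _ = C * Real.exp (-(z.im - c) * x) := by
          rw [abs_of_nonneg hx0, mul_assoc, ← Real.exp_add]; congr 2; ring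
  have hu : Ioi t = Ioc t t₀ ∪ Ioi t₀ := (Ioc_union_Ioi_eq_Ioi (le_max_left t 0)).symm
  rw [hu]
  exact h1.union h2

/-- RH-FREE. **The half-plane formula behind (3.27)₂, both signs at once:** on a solvable window, for
`Im z > c` (the growth rate of `K`),
`𝖥(frakFG ε t)(z) = ½·E(z)·(e^{izt} + ε ∫_{(t,∞)} φ^ε(t,x)e^{izx} dx)` with `E = 𝖥ϱ`
(Fubini: `𝖥[x ↦ ∫_t^∞ ϱ(x−y)φ^ε(t,y) dy](z) = E(z)·∫_t^∞ φ^ε(t,y)e^{izy} dy`). -/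
theorem fourier_frakFG_eq (h : IsSuzukiPair ϱ K) (hsol : ∃ X : ℝ → ℝ, IsSuzukiPhiSolution K ε t X)
    {c CK : ℝ} (hc : 0 ≤ c) (hKle : ∀ x : ℝ, |K x| ≤ CK * Real.exp (c * |x|)) {z : ℂ} (hz : c < z.im) :
    fourier (frakFG ϱ K ε t) z = 1 / 2 * fourier ϱ z *
      (cexp (I * z * t) + ε * ∫ x in Ioi t, (suzukiPhiExt K ε t x : ℂ) * cexp (I * z * x)) := by
  have hK3 : ∀ u : ℝ, u < 0 → K u = 0 := fun u hu => h.kernel_eq_zero u hu.le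
  set φ := suzukiPhiExt K ε t with hφdef
  have hφc : Continuous φ := continuous_suzukiPhiExt h.continuous_kernel hK3 ε t
  -- the two factors of the convolution integrand
  set f : ℝ → ℂ := fun y => (Ioi t).indicator (fun y => (φ y : ℂ) * cexp (I * z * y)) y with hf
  set g : ℝ → ℂ := fun u => (ϱ u : ℂ) * cexp (I * z * u) with hg
  have hfi : Integrable f :=
    (integrable_indicator_iff measurableSet_Ioi).2
      (integrableOn_suzukiPhiExt_mul_cexp_Ioi h.continuous_kernel hK3 hc hKle hsol hz)
  have hgi : Integrable g := integrable_mul_cexp_of_decay h.continuous_rho h.abs_rho_le z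
  -- Fubini integrand `H(x,y) = ϱ(x−y)·𝟙_{(t,∞)}φ(y)·e^{izx} = f(y)·g(x−y)`
  have hH : Integrable (Function.uncurry fun x y : ℝ =>
      ((ϱ (x - y) * (Ioi t).indicator φ y : ℝ) : ℂ) * cexp (I * z * x)) ((volume : Measure ℝ).prod volume) := by
    have hconv := hfi.convolution_integrand (ContinuousLinearMap.mul ℂ ℂ) hgi
    refine hconv.congr (Eventually.of_forall fun p => ?_)
    rcases p with ⟨x, y⟩
    simp only [Function.uncurry_apply_pair, ContinuousLinearMap.mul_apply', hf, hg]
    have hexp : cexp (I * z * (y : ℂ)) * cexp (I * z * ((x - y : ℝ) : ℂ)) = cexp (I * z * (x : ℂ)) := by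
      rw [← Complex.exp_add, Complex.ofReal_sub]; ring_nf
    by_cases hy : y ∈ Ioi t
    · rw [indicator_of_mem hy, indicator_of_mem hy, Complex.ofReal_mul]
      calc (φ y : ℂ) * cexp (I * z * (y : ℂ)) * ((ϱ (x - y) : ℂ) * cexp (I * z * ((x - y : ℝ) : ℂ)))
          = (ϱ (x - y) : ℂ) * (φ y : ℂ) * (cexp (I * z * (y : ℂ)) * cexp (I * z * ((x - y : ℝ) : ℂ))) := by
            ring
        _ = (ϱ (x - y) : ℂ) * (φ y : ℂ) * cexp (I * z * (x : ℂ)) := by rw [hexp]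
    · rw [indicator_of_notMem hy, indicator_of_notMem hy]
      simp
  -- the window term as an iterated integral
  have hW : ∀ x : ℝ, ((∫ y in Ioi t, ϱ (x - y) * φ y : ℝ) : ℂ) * cexp (I * z * x) =
      ∫ y : ℝ, ((ϱ (x - y) * (Ioi t).indicator φ y : ℝ) : ℂ) * cexp (I * z * x) := by
    intro x
    have hcoe : ((∫ y in Ioi t, ϱ (x - y) * φ y : ℝ) : ℂ) =
        ∫ y : ℝ, ((ϱ (x - y) * (Ioi t).indicator φ y : ℝ) : ℂ) := by
      rw [← integral_indicator measurableSet_Ioi]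
      have e : ((∫ y, (Ioi t).indicator (fun y => ϱ (x - y) * φ y) y : ℝ) : ℂ) =
          ∫ y, (((Ioi t).indicator (fun y => ϱ (x - y) * φ y) y : ℝ) : ℂ) := integral_ofReal.symm
      rw [e]
      refine integral_congr_ae (Eventually.of_forall fun y => ?_)
      simp only
      by_cases hy : y ∈ Ioi t
      · rw [indicator_of_mem hy, indicator_of_mem hy]
      · rw [indicator_of_notMem hy, indicator_of_notMem hy, mul_zero]
    rw [hcoe, integral_mul_const]
  -- inner `x`-integrals: `∫ ϱ(x−y)e^{izx} dx = e^{izy}E(z)`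
  have hinner : ∀ y : ℝ, ∫ x : ℝ, ((ϱ (x - y) * (Ioi t).indicator φ y : ℝ) : ℂ) * cexp (I * z * x) =
      (((Ioi t).indicator φ y : ℝ) : ℂ) * (cexp (I * z * y) * fourier ϱ z) := by
    intro y
    rw [← fourier_comp_sub ϱ y z, fourier_def, ← integral_const_mul]
    refine integral_congr_ae (Eventually.of_forall fun x => ?_)
    simp only
    push_cast
    ring
  -- assemble
  have hsplit : fourier (frakFG ϱ K ε t) z =
      1 / 2 * (fourier (fun x => ϱ (x - t)) z +
        ε * ∫ x : ℝ, ((∫ y in Ioi t, ϱ (x - y) * φ y : ℝ) : ℂ) * cexp (I * z * x)) := by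
    rw [fourier_def, fourier_def, ← integral_const_mul, ← integral_add, ← integral_const_mul]
    · refine integral_congr_ae (Eventually.of_forall fun x => ?_)
      simp only [frakFG_def, ← hφdef]
      push_cast
      ring
    · exact integrable_mul_cexp_of_decay (h.continuous_rho.comp (continuous_id.sub continuous_const))
        (decay_comp_sub h.abs_rho_le t) z
    · refine Integrable.const_mul ?_ _
      have := hH.integral_prod_left
      refine this.congr (Eventually.of_forall fun x => ?_)
      simp only
      exact (hW x).symm
  rw [hsplit, fourier_comp_sub]
  simp_rw [hW]
  rw [integral_integral_swap hH]
  simp_rw [hinner]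
  have hind : (fun y : ℝ => (((Ioi t).indicator φ y : ℝ) : ℂ) * (cexp (I * z * y) * fourier ϱ z)) =
      fun y => (Ioi t).indicator (fun y => (φ y : ℂ) * cexp (I * z * y)) y * fourier ϱ z := by
    funext y
    by_cases hy : y ∈ Ioi t
    · rw [indicator_of_mem hy, indicator_of_mem hy]; ring
    · rw [indicator_of_notMem hy, indicator_of_notMem hy]; simp
  rw [hind, integral_mul_const, integral_indicator measurableSet_Ioi]
  ring

/-- RH-FREE. **(3.27)₂ for `𝔄`, AS PRINTED:** `𝔄(t,z) = ½E(z)(e^{izt} + ∫_t^∞ φ⁺(t,x)e^{izx} dx)` for `Im z > c`,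
with `E = 𝖥ϱ`, on a solvable `φ⁺`-window. -/
theorem frakA_eq_halfPlane (h : IsSuzukiPair ϱ K) (hsol : ∃ X : ℝ → ℝ, IsSuzukiPhiSolution K 1 t X)
    {c CK : ℝ} (hc : 0 ≤ c) (hKle : ∀ x : ℝ, |K x| ≤ CK * Real.exp (c * |x|)) {z : ℂ} (hz : c < z.im) :
    frakA ϱ K t z = 1 / 2 * fourier ϱ z *
      (cexp (I * z * t) + ∫ x in Ioi t, (suzukiPhiExt K 1 t x : ℂ) * cexp (I * z * x)) := by
  rw [frakA_def, frakF_def, fourier_frakFG_eq h hsol hc hKle hz]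
  simp

/-- RH-FREE. **(3.27)₂ for `𝔅`, AS PRINTED:** `−i𝔅(t,z) = ½E(z)(e^{izt} − ∫_t^∞ φ⁻(t,x)e^{izx} dx)` for `Im z > c`,
on a solvable `φ⁻`-window. -/
theorem neg_I_mul_frakB_eq_halfPlane (h : IsSuzukiPair ϱ K) (hsol : ∃ X : ℝ → ℝ, IsSuzukiPhiSolution K (-1) t X)
    {c CK : ℝ} (hc : 0 ≤ c) (hKle : ∀ x : ℝ, |K x| ≤ CK * Real.exp (c * |x|)) {z : ℂ} (hz : c < z.im) :
    -I * frakB ϱ K t z = 1 / 2 * fourier ϱ z *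
      (cexp (I * z * t) - ∫ x in Ioi t, (suzukiPhiExt K (-1) t x : ℂ) * cexp (I * z * x)) := by
  rw [neg_I_mul_frakB, frakG_def, fourier_frakFG_eq h hsol hc hKle hz]
  simp [sub_eq_add_neg]

/-- RH-FREE. **`E(t,z)` from the kernel, explicitly, on `Im z > c`:**
`E(t,z) = ½E(z)·( m(t)(e^{izt} + ∫_t^∞ φ⁺(t,x)e^{izx}dx) + m(t)⁻¹(e^{izt} − ∫_t^∞ φ⁻(t,x)e^{izx}dx) )` on a clean
window — the structure function of the chain is the initial `E` times explicit Laplace transforms of the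
solutions `φ^{±}(t,·)` of the integral equations ((3.27), (3.38), (3.39) combined). -/
theorem structE_eq_halfPlane (h : IsSuzukiPair ϱ K) (hp : ∃ X : ℝ → ℝ, IsSuzukiPhiSolution K 1 t X)
    (hm : ∃ X : ℝ → ℝ, IsSuzukiPhiSolution K (-1) t X)
    {c CK : ℝ} (hc : 0 ≤ c) (hKle : ∀ x : ℝ, |K x| ≤ CK * Real.exp (c * |x|)) {z : ℂ} (hz : c < z.im) :
    structE ϱ K t z = 1 / 2 * fourier ϱ z *
      ((m K t : ℂ) * (cexp (I * z * t) + ∫ x in Ioi t, (suzukiPhiExt K 1 t x : ℂ) * cexp (I * z * x)) +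
        ((m K t)⁻¹ : ℝ) * (cexp (I * z * t) - ∫ x in Ioi t, (suzukiPhiExt K (-1) t x : ℂ) * cexp (I * z * x))) := by
  rw [structE_eq, frakF_def, frakG_def, fourier_frakFG_eq h hp hc hKle hz, fourier_frakFG_eq h hm hc hKle hz]
  push_cast
  ring

end Summit.RiemannHypothesis.RiemannHypothesis.Theorems.SuzukiStructureFunctions

end
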